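import Summits.CriticalPhenomena.CardyFormulaZ2.Theorems.CardyIKTransportIKLinearTransportScreeningArrayExact

/-!
# Screening estimates for a finite array of independent biased bits, part 6: `sigmaExact_small`

Support file (`--supports stmt-CriticalPhenomena-5076`, registered sub-goal `sigmaExact_small`) for the line
`pinned-diagram-exchange` (crux `IKLinearTransport`); continues part 5 (`…ScreeningArrayExact`, `sigmaExact`).
The exact screening sum tends to `0` uniformly over the array sizes `n ≤ m, k ≤ K n` (`0 ≤ θ ≤ 1/8`).
Elementary majorisation of the closed form (`k = n + d`, `m = n + d'`, `x = θ^n`):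
* `(a + b)^n ≤ a^n + b^n + 2^n a b` for `a, b ∈ [0,1]` (the mixed binomial monomials are `≤ a b`), applied to
  `a = θ^{k-ρ}`, `b = θ^ρ` (`a b = θ^k`): `(θ^{k-ρ} + θ^ρ)^n ≤ x^{n-b₁} x^{d-r₂} + x^{b₁} x^{r₂} + 2^n θ^k`;
* `θ^{n-b₁} + θ^{b₁} ≤ 1 + x` (`2θ ≤ 1`);
* summing the three separable terms with the binomial theorem:
  `sigmaExact + 2 ≤ (1+x)^{d'} (2 (1+x)^{n+d} + (4θ)^n (2θ)^d) ≤ 2 (1+x)^{m+k-n} + 3 (4θ)^n`,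
  and `(1+x)^{L} ≤ exp (L x) ≤ 1 + 2 L x` for `L x ≤ 1`, `L ≤ 2 K n`; finally `n (4θ)^n → 0`
  (`tendsto_self_mul_const_pow_of_lt_one`).
-/

noncomputable section

namespace Summit.CriticalPhenomena.CardyFormulaZ2.Theorems.IKLinearTransport.PinnedDiagramExchange.ScreeningArray

open Finset

/-! ## Elementary inequalities -/

/-- Middle binomial terms: `(a + b)^{j+1} ≤ a^{j+1} + b^{j+1} + (2^{j+1} - 2) a b` for `a, b ∈ [0, 1]`
(each mixed monomial is `≤ a b`). -/
theorem add_pow_succ_le_of_le_one {a b : ℝ} (ha0 : 0 ≤ a) (ha1 : a ≤ 1) (hb0 : 0 ≤ b) (hb1 : b ≤ 1)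
    (j : ℕ) : (a + b) ^ (j + 1) ≤ a ^ (j + 1) + b ^ (j + 1) + (2 ^ (j + 1) - 2) * (a * b) := by
  induction j with
  | zero => norm_num
  | succ j ih =>
    have hA1 : a ^ j ≤ 1 := pow_le_one₀ ha0 ha1
    have hB1 : b ^ j ≤ 1 := pow_le_one₀ hb0 hb1
    have hA0 : 0 ≤ a ^ j := pow_nonneg ha0 j
    have hB0 : 0 ≤ b ^ j := pow_nonneg hb0 j
    have hP : (2 : ℝ) ≤ 2 ^ (j + 1) := by
      calc (2 : ℝ) = 2 ^ 1 := by norm_num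
        _ ≤ 2 ^ (j + 1) := pow_le_pow_right₀ (by norm_num) (by omega)
    have hab : 0 ≤ a * b := mul_nonneg ha0 hb0
    have e1 : (a + b) ^ (j + 1 + 1) = (a + b) * (a + b) ^ (j + 1) := by ring
    have e5 : a ^ (j + 1) = a * a ^ j := by ring
    have e6 : b ^ (j + 1) = b * b ^ j := by ring
    rw [e5, e6] at ih
    have hmul : (2 ^ (j + 1) - 2) * (a + b) ≤ (2 ^ (j + 1) - 2) * 2 :=
      mul_le_mul_of_nonneg_left (by linarith) (by linarith)
    have hinner : 0 ≤ (2 * 2 ^ (j + 1) - 2) - b ^ j - a ^ j - (2 ^ (j + 1) - 2) * (a + b) := by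
      nlinarith
    have hkey := mul_nonneg hab hinner
    calc (a + b) ^ (j + 1 + 1) = (a + b) * (a + b) ^ (j + 1) := e1
      _ ≤ (a + b) * (a * a ^ j + b * b ^ j + (2 ^ (j + 1) - 2) * (a * b)) :=
          mul_le_mul_of_nonneg_left ih (by positivity)
      _ ≤ a ^ (j + 1 + 1) + b ^ (j + 1 + 1) + (2 ^ (j + 1 + 1) - 2) * (a * b) := by
          rw [← sub_nonneg]
          have : a ^ (j + 1 + 1) + b ^ (j + 1 + 1) + (2 ^ (j + 1 + 1) - 2) * (a * b) -
              (a + b) * (a * a ^ j + b * b ^ j + (2 ^ (j + 1) - 2) * (a * b)) =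
              a * b * ((2 * 2 ^ (j + 1) - 2) - b ^ j - a ^ j - (2 ^ (j + 1) - 2) * (a + b)) := by ring
          rw [this]
          exact hkey

/-- `(a + b)^n ≤ a^n + b^n + 2^n a b` for `a, b ∈ [0, 1]`, `n ≥ 1`. -/
theorem add_pow_le_of_le_one {a b : ℝ} (ha0 : 0 ≤ a) (ha1 : a ≤ 1) (hb0 : 0 ≤ b) (hb1 : b ≤ 1)
    {n : ℕ} (hn : 1 ≤ n) : (a + b) ^ n ≤ a ^ n + b ^ n + 2 ^ n * (a * b) := by
  obtain ⟨j, rfl⟩ : ∃ j, n = j + 1 := ⟨n - 1, by omega⟩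
  have h := add_pow_succ_le_of_le_one ha0 ha1 hb0 hb1 j
  nlinarith [mul_nonneg ha0 hb0]

/-- The high-column factor: `θ^{n-b} + θ^b ≤ 1 + θ^n` for `b ≤ n`, `0 ≤ θ ≤ 1/2`. -/
theorem pow_sub_add_pow_le {θ : ℝ} (hθ0 : 0 ≤ θ) (hθ2 : θ ≤ 1 / 2) {n b : ℕ} (hb : b ≤ n) :
    θ ^ (n - b) + θ ^ b ≤ 1 + θ ^ n := by
  have hθ1 : θ ≤ 1 := by linarith
  rcases Nat.eq_zero_or_pos b with rfl | hb0
  · simp [add_comm]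
  · rcases eq_or_lt_of_le hb with rfl | hbn
    · simp
    · have h1 : θ ^ (n - b) ≤ θ := by
        calc θ ^ (n - b) ≤ θ ^ 1 := pow_le_pow_of_le_one hθ0 hθ1 (by omega)
          _ = θ := pow_one θ
      have h2 : θ ^ b ≤ θ := by
        calc θ ^ b ≤ θ ^ 1 := pow_le_pow_of_le_one hθ0 hθ1 hb0
          _ = θ := pow_one θ
      have h3 : 0 ≤ θ ^ n := pow_nonneg hθ0 n
      linarith

/-- Binomial sums: `Σ_b C(n,b) u^b = (u + 1)^n`. -/
theorem sum_choose_mul_pow_eq (n : ℕ) (u : ℝ) :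
    ∑ b ∈ range (n + 1), (n.choose b : ℝ) * u ^ b = (u + 1) ^ n := by
  rw [add_pow]
  exact Finset.sum_congr rfl fun b _ => by rw [one_pow, mul_one, mul_comm]

/-- Binomial sums: `Σ_b C(n,b) u^{n-b} = (1 + u)^n`. -/
theorem sum_choose_mul_pow_sub_eq (n : ℕ) (u : ℝ) :
    ∑ b ∈ range (n + 1), (n.choose b : ℝ) * u ^ (n - b) = (1 + u) ^ n := by
  rw [add_pow]
  exact Finset.sum_congr rfl fun b _ => by rw [one_pow, one_mul, mul_comm]

/-- Binomial sums: `Σ_b C(n,b) = 2^n`. -/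
theorem sum_choose_cast_eq (n : ℕ) : ∑ b ∈ range (n + 1), (n.choose b : ℝ) = 2 ^ n := by
  have h := sum_choose_mul_pow_eq n 1
  simp only [one_pow, mul_one] at h
  rw [h]
  norm_num

/-- POINTWISE MAJORANT of the exact screening sum (`k = n + d`, `m = n + d'`, `0 ≤ θ ≤ 1/2`, `n ≥ 1`):
`sigmaExact + 2 ≤ (1 + θ^n)^{d'} (2 (1+θ^n)^n (1+θ^n)^d + 2^n θ^{n+d} 2^n 2^d)`, by
`(θ^{k-ρ} + θ^ρ)^n ≤ θ^{n(k-ρ)} + θ^{nρ} + 2^n θ^k` and `θ^{n-b₁} + θ^{b₁} ≤ 1 + θ^n`, the binomial theorem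
summing the three separable terms. -/
theorem sigmaExact_add_two_le {θ : ℝ} (hθ0 : 0 ≤ θ) (hθ2 : θ ≤ 1 / 2) {n : ℕ} (hn : 1 ≤ n) (d d' : ℕ) :
    sigmaExact (n + d') (n + d) n θ + 2 ≤
      (1 + θ ^ n) ^ d' * ((θ ^ n + 1) ^ n * (θ ^ n + 1) ^ d + (1 + θ ^ n) ^ n * (1 + θ ^ n) ^ d +
        2 ^ n * θ ^ (n + d) * (2 ^ n * 2 ^ d)) := by
  have hθ1 : θ ≤ 1 := by linarith
  unfold sigmaExact
  rw [sub_add_cancel, Nat.add_sub_cancel_left, Nat.add_sub_cancel_left]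
  set x := θ ^ n with hx
  set c := (2 : ℝ) ^ n * θ ^ (n + d) with hc
  set W := (1 + x) ^ d' with hW
  -- pointwise bound
  have hpt : ∀ b ∈ range (n + 1), ∀ r ∈ range (d + 1),
      (n.choose b : ℝ) * (d.choose r : ℝ) * (θ ^ (n + d - b - r) + θ ^ (b + r)) ^ n *
          (θ ^ (n - b) + θ ^ b) ^ d' ≤
        W * ((n.choose b : ℝ) * x ^ b * ((d.choose r : ℝ) * x ^ r) +
          (n.choose b : ℝ) * x ^ (n - b) * ((d.choose r : ℝ) * x ^ (d - r)) +
          c * (n.choose b : ℝ) * (d.choose r : ℝ)) := by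
    intro b hb r hr
    rw [Finset.mem_range] at hb hr
    have he : n + d - b - r = (n - b) + (d - r) := by omega
    have ha1 : θ ^ (n + d - b - r) ≤ 1 := pow_le_one₀ hθ0 hθ1
    have hb1 : θ ^ (b + r) ≤ 1 := pow_le_one₀ hθ0 hθ1
    have hA := add_pow_le_of_le_one (pow_nonneg hθ0 _) ha1 (pow_nonneg hθ0 _) hb1 hn
      (a := θ ^ (n + d - b - r)) (b := θ ^ (b + r))
    have hAn : (θ ^ (n + d - b - r)) ^ n = x ^ (n - b) * x ^ (d - r) := by
      rw [hx, ← pow_mul, ← pow_add, ← pow_mul, he, mul_comm]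
    have hBn : (θ ^ (b + r)) ^ n = x ^ b * x ^ r := by
      rw [hx, ← pow_mul, ← pow_add, ← pow_mul, mul_comm]
    have hAB : θ ^ (n + d - b - r) * θ ^ (b + r) = θ ^ (n + d) := by
      rw [← pow_add]
      congr 1
      omega
    rw [hAn, hBn, hAB] at hA
    have hB : (θ ^ (n - b) + θ ^ b) ^ d' ≤ W :=
      pow_le_pow_left₀ (by positivity) (pow_sub_add_pow_le hθ0 hθ2 (by omega)) d'
    have hC : 0 ≤ (n.choose b : ℝ) * (d.choose r : ℝ) := by positivity
    calc (n.choose b : ℝ) * (d.choose r : ℝ) * (θ ^ (n + d - b - r) + θ ^ (b + r)) ^ n *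
          (θ ^ (n - b) + θ ^ b) ^ d'
        = (n.choose b : ℝ) * (d.choose r : ℝ) * ((θ ^ (n + d - b - r) + θ ^ (b + r)) ^ n *
          (θ ^ (n - b) + θ ^ b) ^ d') := by ring
      _ ≤ (n.choose b : ℝ) * (d.choose r : ℝ) *
          ((x ^ (n - b) * x ^ (d - r) + x ^ b * x ^ r + 2 ^ n * θ ^ (n + d)) * W) :=
          mul_le_mul_of_nonneg_left (mul_le_mul hA hB (by positivity) (by positivity)) hC
      _ = _ := by rw [hc]; ring
  -- the three separable sums
  have hS1 : ∑ b ∈ range (n + 1), ∑ r ∈ range (d + 1),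
      (n.choose b : ℝ) * x ^ b * ((d.choose r : ℝ) * x ^ r) = (x + 1) ^ n * (x + 1) ^ d := by
    rw [← Finset.sum_mul_sum, sum_choose_mul_pow_eq, sum_choose_mul_pow_eq]
  have hS2 : ∑ b ∈ range (n + 1), ∑ r ∈ range (d + 1),
      (n.choose b : ℝ) * x ^ (n - b) * ((d.choose r : ℝ) * x ^ (d - r)) = (1 + x) ^ n * (1 + x) ^ d := by
    rw [← Finset.sum_mul_sum, sum_choose_mul_pow_sub_eq, sum_choose_mul_pow_sub_eq]
  have hS3 : ∑ b ∈ range (n + 1), ∑ r ∈ range (d + 1), c * (n.choose b : ℝ) * (d.choose r : ℝ) =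
      c * (2 ^ n * 2 ^ d) := by
    rw [← Finset.sum_mul_sum, ← Finset.mul_sum, sum_choose_cast_eq, sum_choose_cast_eq, mul_assoc]
  calc (∑ b ∈ range (n + 1), ∑ r ∈ range (d + 1),
        (n.choose b : ℝ) * (d.choose r : ℝ) * (θ ^ (n + d - b - r) + θ ^ (b + r)) ^ n *
          (θ ^ (n - b) + θ ^ b) ^ d')
      ≤ ∑ b ∈ range (n + 1), ∑ r ∈ range (d + 1),
          W * ((n.choose b : ℝ) * x ^ b * ((d.choose r : ℝ) * x ^ r) +
            (n.choose b : ℝ) * x ^ (n - b) * ((d.choose r : ℝ) * x ^ (d - r)) +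
            c * (n.choose b : ℝ) * (d.choose r : ℝ)) :=
        Finset.sum_le_sum fun b hb => Finset.sum_le_sum fun r hr => hpt b hb r hr
    _ = W * ((x + 1) ^ n * (x + 1) ^ d + (1 + x) ^ n * (1 + x) ^ d + c * (2 ^ n * 2 ^ d)) := by
        rw [← hS1, ← hS2, ← hS3, ← Finset.sum_add_distrib, ← Finset.sum_add_distrib, Finset.mul_sum]
        refine Finset.sum_congr rfl fun b _ => ?_
        rw [← Finset.sum_add_distrib, ← Finset.sum_add_distrib, Finset.mul_sum]

/-! ## The sub-goal -/

/-- REGISTERED SUB-GOAL `sigmaExact_small` — for every aspect bound `K` the exact screening sum tends to zero,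
uniformly over the array sizes `n ≤ m, k ≤ K n` (`θ ≤ 1/8`). [folklore] -/
theorem sigmaExact_small :
    ∀ (θ : ℝ), 0 ≤ θ → θ ≤ 1 / 8 → ∀ (K : ℕ) (ε : ℝ), 0 < ε → ∃ N : ℕ, 1 ≤ N ∧ ∀ n : ℕ, N ≤ n →
      ∀ m k : ℕ, n ≤ m → m ≤ K * n → n ≤ k → k ≤ K * n → sigmaExact m k n θ ≤ ε := by
  intro θ hθ0 hθ8 K ε hε
  have hθ2 : θ ≤ 1 / 2 := by linarith
  -- the rate `u n = n (4θ)^n → 0`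
  have hu : Filter.Tendsto (fun n : ℕ => (n : ℝ) * (4 * θ) ^ n) Filter.atTop (nhds 0) :=
    tendsto_self_mul_const_pow_of_lt_one (by positivity) (by linarith)
  have hδ : (0 : ℝ) < min ε 1 / (8 * K + 8) := by positivity
  obtain ⟨N₀, hN₀⟩ := Filter.eventually_atTop.1 (hu.eventually_lt_const hδ)
  refine ⟨max N₀ 1, le_max_right _ _, fun n hn m k hnm hmK hnk hkK => ?_⟩
  have hn1 : 1 ≤ n := le_trans (le_max_right _ _) hn
  have hun : (n : ℝ) * (4 * θ) ^ n < min ε 1 / (8 * K + 8) := hN₀ n (le_trans (le_max_left _ _) hn)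
  have hmin1 : min ε 1 ≤ 1 := min_le_right _ _
  have hminε : min ε 1 ≤ ε := min_le_left _ _
  have hK0 : (0 : ℝ) ≤ K := Nat.cast_nonneg K
  obtain ⟨d', rfl⟩ := Nat.exists_eq_add_of_le hnm
  obtain ⟨d, rfl⟩ := Nat.exists_eq_add_of_le hnk
  have hmaj := sigmaExact_add_two_le hθ0 hθ2 hn1 d d'
  set u := (n : ℝ) * (4 * θ) ^ n with hudef
  set x := θ ^ n with hx
  have hx0 : 0 ≤ x := pow_nonneg hθ0 n
  have hx4 : x ≤ (4 * θ) ^ n := pow_le_pow_left₀ hθ0 (by linarith) n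
  have h4n : (4 * θ) ^ n ≤ u := by
    have hone : (1 : ℝ) ≤ n := by exact_mod_cast hn1
    exact le_mul_of_one_le_left (by positivity) hone
  have huδ : u * (8 * K + 8) < min ε 1 := by
    have := (lt_div_iff₀ (show (0 : ℝ) < 8 * K + 8 by positivity)).mp hun
    linarith
  -- the total exponent `L = d' + n + d ≤ 2 K n`
  have hm' : ((n : ℝ) + d') ≤ K * n := by exact_mod_cast hmK
  have hk' : ((n : ℝ) + d) ≤ K * n := by exact_mod_cast hkK
  have hL : ((d' + n + d : ℕ) : ℝ) * x ≤ 2 * K * u := by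
    have h1 : ((d' + n + d : ℕ) : ℝ) ≤ 2 * K * n := by push_cast; linarith
    calc ((d' + n + d : ℕ) : ℝ) * x ≤ (2 * K * n) * (4 * θ) ^ n :=
          mul_le_mul h1 hx4 hx0 (by positivity)
      _ = 2 * K * u := by rw [hudef]; ring
  have hLx0 : 0 ≤ ((d' + n + d : ℕ) : ℝ) * x := by positivity
  have hLx1 : ((d' + n + d : ℕ) : ℝ) * x ≤ 1 := by nlinarith
  -- `(1 + x)^L ≤ exp (L x) ≤ 1 + 2 L x`
  have hpowL : (1 + x) ^ (d' + n + d) ≤ 1 + 2 * (((d' + n + d : ℕ) : ℝ) * x) := by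
    have h1 : (1 + x) ^ (d' + n + d) ≤ Real.exp (((d' + n + d : ℕ) : ℝ) * x) := by
      calc (1 + x) ^ (d' + n + d) ≤ (Real.exp x) ^ (d' + n + d) :=
            pow_le_pow_left₀ (by positivity) (by linarith [Real.add_one_le_exp x]) _
        _ = Real.exp (((d' + n + d : ℕ) : ℝ) * x) := (Real.exp_nat_mul x _).symm
    have h2 : Real.exp (((d' + n + d : ℕ) : ℝ) * x) - 1 ≤ 2 * (((d' + n + d : ℕ) : ℝ) * x) := by
      have habs : |((d' + n + d : ℕ) : ℝ) * x| ≤ 1 := by rw [abs_of_nonneg hLx0]; exact hLx1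
      have := Real.abs_exp_sub_one_le habs
      rw [abs_of_nonneg hLx0] at this
      exact le_trans (le_abs_self _) this
    linarith
  have h1x : (1 : ℝ) ≤ 1 + x := by linarith
  have hWle : (1 + x) ^ d' ≤ (1 + x) ^ (d' + n + d) := pow_le_pow_right₀ h1x (by omega)
  have hW3 : (1 + x) ^ d' ≤ 3 := by linarith
  have hW0 : 0 ≤ (1 + x) ^ d' := by positivity
  -- the product term `2^n θ^{n+d} 2^n 2^d = (4θ)^n (2θ)^d ≤ (4θ)^n`
  have hprod : (2 : ℝ) ^ n * θ ^ (n + d) * (2 ^ n * 2 ^ d) ≤ (4 * θ) ^ n := by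
    have e : (2 : ℝ) ^ n * θ ^ (n + d) * (2 ^ n * 2 ^ d) = (4 * θ) ^ n * (2 * θ) ^ d := by
      rw [pow_add, mul_pow, mul_pow, show (4 : ℝ) ^ n = 2 ^ n * 2 ^ n by rw [← mul_pow]; norm_num]
      ring
    rw [e]
    exact mul_le_of_le_one_right (by positivity) (pow_le_one₀ (by positivity) (by linarith))
  -- assembling
  have hmain : (1 + x) ^ d' * ((x + 1) ^ n * (x + 1) ^ d + (1 + x) ^ n * (1 + x) ^ d +
      2 ^ n * θ ^ (n + d) * (2 ^ n * 2 ^ d)) ≤ 2 * (1 + 2 * (((d' + n + d : ℕ) : ℝ) * x)) + 3 * (4 * θ) ^ n := by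
    have e1 : (x + 1) ^ n * (x + 1) ^ d = (1 + x) ^ n * (1 + x) ^ d := by rw [add_comm]
    have e2 : (1 + x) ^ d' * ((1 + x) ^ n * (1 + x) ^ d) = (1 + x) ^ (d' + n + d) := by
      rw [pow_add, pow_add]; ring
    rw [e1]
    have hsplit : (1 + x) ^ d' * ((1 + x) ^ n * (1 + x) ^ d + (1 + x) ^ n * (1 + x) ^ d +
        2 ^ n * θ ^ (n + d) * (2 ^ n * 2 ^ d)) =
        2 * (1 + x) ^ (d' + n + d) + (1 + x) ^ d' * (2 ^ n * θ ^ (n + d) * (2 ^ n * 2 ^ d)) := by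
      rw [← e2]; ring
    rw [hsplit]
    have h3 : (1 + x) ^ d' * (2 ^ n * θ ^ (n + d) * (2 ^ n * 2 ^ d)) ≤ 3 * (4 * θ) ^ n :=
      mul_le_mul hW3 hprod (by positivity) (by norm_num)
    linarith
  have hfin : sigmaExact (n + d') (n + d) n θ ≤ 4 * (((d' + n + d : ℕ) : ℝ) * x) + 3 * (4 * θ) ^ n := by
    linarith
  calc sigmaExact (n + d') (n + d) n θ ≤ 4 * (((d' + n + d : ℕ) : ℝ) * x) + 3 * (4 * θ) ^ n := hfin
    _ ≤ 4 * (2 * K * u) + 3 * u := by linarith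
    _ = u * (8 * K + 3) := by ring
    _ ≤ u * (8 * K + 8) := by nlinarith [show (0 : ℝ) ≤ u by positivity]
    _ ≤ ε := by linarith

end Summit.CriticalPhenomena.CardyFormulaZ2.Theorems.IKLinearTransport.PinnedDiagramExchange.ScreeningArray
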